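import Summits.KontsevichZagierPeriods.Zeta5Search.CasoratianClassBoundShift
import Summits.KontsevichZagierPeriods.Zeta5Search.UniversalDigitV
import Summits.KontsevichZagierPeriods.Zeta5Search.WrappedDivisibilityUProof
import HarnessLib

/-!
# RVLargeParamVULayer — the U-LAYER case of the constant-term floor (V⁺), PROVED (fam-rv gen 9, file 2)

HONEST FRAMING: systematic search; no irrationality claim unless certified.  This file mints NO conjecture: it PROVES, from tree
theorems only, a `p`-adic lower bound `v_p V(c) ≥ −4` for the canonical constant term `V(c)` of the Brown–Zudilin cellular form
under a decidable configuration test `uLayerCase c p t` (`ClusterValuation.val_ge_of_uLayer`).  It is one of the three proved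
cases of fam-rv gen 9's constant-term floor (V⁺) (`RVLargeParamVFloor.lean`, `RVLargeParamVCases.lean`).  `p`-adic valuations of
rational numbers only; nothing about irrationality.

THE MECHANISM (level-one layer expansion).  Call a residue class DEFICIENT if it is a pole class with `ν_x < −4` (`defClass`;
`ν_x = classNu`, the termwise bound of `classNuBound`), and let `Q` (`qSet`) be the set of poles lying in deficient classes.  In the
configurations of the test every deficient class has exactly one pole `q`, at LEVEL ONE (`p ≤ q < 2p`), and `Q` is closed under the
reflection `q ↦ b₀ − q`.  At level one `H_q^{(σ)} = p^{−σ} + (p-integral)` EXACTLY (`CellA.padicNorm_harm_sub_level_le_one`), and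
the residues of an isolated pole are `p`-integral (Theorem A′, `isolatedPoleIntegral_holds`); hence modulo terms of norm `≤ 1`
    `Σ_{x deficient} V_x ≡ Σ_{σ=1}^{6} p^{−σ} T_σ`,   `T_σ = Σ_{q ∈ Q} c_{σ−1,q}`   (`layerSum`).
The layers `σ ≤ 4` have norm `≤ p⁴`; the TOP LAYER `T_6 = Σ_Q c_{5,q}` VANISHES by the reflection antisymmetry
`c_{5,b₀−q} = −c_{5,q}` (`CellA.pfData_reflect`) on the symmetric set `Q` (`layerSum_five_eq_zero`); and `T_5 ≡ U(c) (mod p)`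
because every pole of order `≥ 5` outside `Q` lies in a class of exponent `≥ −4` (Theorem A, `clusterBound_holds`), so
`‖T_5‖ ≤ p⁻¹` by THEOREM C for `U` (`wrappedDivisibilityU_holds`: `p ∣ U(c)` for `4p ≤ 2d+3` under `H(5)`;
`padicNorm_layerSum_four_le`).  The non-deficient classes are bounded termwise (`padicNorm_classV_le`).  Coverage (exact
census `pub-zeta5-fam-rv/gen9/rv9_ulayer.py`, `out/ulayer_6_19.json`, `out/ulayer_20_22.json`): the test fires on 189 of the 288
pairs left residual by the counting and palindromic tests (`b₀ ≤ 22`), e.g. on the `δ = 2` archetype `b = (12;5,5,4,4,4,4,0)`,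
`p = 5` (`Q = {5,6,7}`: two sextic poles and the quintic centre pole); the bound was re-checked exactly on all 298 firing pairs.
-/

noncomputable section

open Finset

namespace Summit.KontsevichZagierPeriods.Zeta5Search.ClusterValuation

open Summit.KontsevichZagierPeriods.Zeta5Search.WedgeDictionary (coeffV dOf)
open Summit.KontsevichZagierPeriods.Zeta5Search.CasoratianValuation (InPolytope)
open Summit.KontsevichZagierPeriods.Zeta5Search.PadicSeries

variable {p : ℕ} [hp : Fact p.Prime]

section ULayer

open Summit.KontsevichZagierPeriods.Zeta5Search.WedgeDictionary (pfData coeffU)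
open Literature.NumberTheory.Transcendental.BallRivoal (harm)

/-- DEFICIENT class (Boolean test): a pole class with `ν_x < −4`. -/
def defClass (c : ℕ → ℤ) (p x : ℕ) : Bool := decide (1 ≤ classPoleCount c p x) && decide (classNu c p x < -4)

/-- Position `s` is a pole lying in a deficient class (Boolean test). -/
def inQ (c : ℕ → ℤ) (p s : ℕ) : Bool := decide (netExp c s < 0) && defClass c p (s % p)

omit hp in
/-- Unfolding of the Boolean test `defClass`. -/
theorem defClass_iff (c : ℕ → ℤ) (p x : ℕ) : defClass c p x = true ↔ 1 ≤ classPoleCount c p x ∧ classNu c p x < -4 := by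
  simp [defClass]

omit hp in
/-- Unfolding of the Boolean test `inQ`. -/
theorem inQ_iff (c : ℕ → ℤ) (p s : ℕ) : inQ c p s = true ↔ netExp c s < 0 ∧ defClass c p (s % p) = true := by
  simp only [inQ, Bool.and_eq_true, decide_eq_true_eq]

/-- The set `Q` of deficient poles. -/
def qSet (c : ℕ → ℤ) (p : ℕ) : Finset ℕ := (range ((c 0).toNat + 1)).filter fun s => inQ c p s = true

/-- The layer sums `T_{o+1} = Σ_{q ∈ Q} c_{o,q}`. -/
noncomputable def layerSum (c : ℕ → ℤ) (p o : ℕ) : ℚ := ∑ s ∈ qSet c p, pfData c o s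

/-- The position summand of `V`: `Σ_{o<6} c_{o,s} H_s^{(o+1)}` (so `V_x = Σ_{s ∈ x} posV s`). -/
noncomputable def posV (c : ℕ → ℤ) (s : ℕ) : ℚ := ∑ o ∈ range 6, pfData c o s * harm (o + 1) s

/-- Its `p`-singular part at level one: `Σ_{o<6} c_{o,s} p^{−(o+1)}`. -/
noncomputable def posVsing (c : ℕ → ℤ) (p s : ℕ) : ℚ := ∑ o ∈ range 6, pfData c o s / (p : ℚ) ^ (o + 1)

/-- U-LAYER configuration test (decidable): target `t ≤ −4`; THEOREM C applies to `U` (`4p ≤ 2d+3`, `H(5)`); every deficient class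
has exactly one pole, at level one, whose mirror image `b₀ − q` is again a deficient pole; every pole of order `≥ 5` in a
non-deficient class has class exponent `≥ −4`. -/
def uLayerCase (c : ℕ → ℤ) (p : ℕ) (t : ℤ) : Bool :=
  decide (t ≤ -4) && decide (4 * (p : ℤ) ≤ 2 * dOf c + 3) && decide (GoodClasses c p 5) &&
    decide (∀ x ∈ range p, defClass c p x = true → classPoleCount c p x = 1 ∧
      ∀ s ∈ classSet c p x, netExp c s < 0 → p ≤ s ∧ s < 2 * p ∧ inQ c p ((c 0).toNat - s) = true) &&
    decide (∀ x ∈ range p, defClass c p x = false → ∀ s ∈ classSet c p x, netExp c s ≤ -5 → -4 ≤ classExp c p x)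

omit hp in
/-- A position lies in the class of its residue. -/
theorem mem_classSet_mod (c : ℕ → ℤ) {s : ℕ} (hs : s ≤ (c 0).toNat) : s ∈ classSet c p (s % p) :=
  mem_filter.2 ⟨mem_range.2 (by omega), by simp⟩

omit hp in
/-- The pole count of the class of `s` may be read at `s` or at `s % p`. -/
theorem classPoleCount_mod (c : ℕ → ℤ) (p s : ℕ) : classPoleCount c p s = classPoleCount c p (s % p) := by
  unfold classPoleCount classSet; simp only [Nat.mod_mod]

/-- **Level one:** `H_s^{(σ)} − p^{−σ}` is `p`-integral for `p ≤ s < 2p`. -/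
theorem padicNorm_harm_sub_inv_pow_le_one {s : ℕ} (hps : p ≤ s) (hs2 : s < 2 * p) (σ : ℕ) :
    padicNorm p (harm σ s - 1 / (p : ℚ) ^ σ) ≤ 1 := by
  have h := CellA.padicNorm_harm_sub_level_le_one (p := p) σ s
  have hdiv : s / p = 1 := Nat.div_eq_of_lt_le (by omega) (by omega)
  have h1 : harm σ 1 = 1 := by simp [harm]
  rwa [hdiv, h1] at h

/-- Residues of an isolated pole are `p`-integral (Theorem A′, norm form). -/
theorem padicNorm_pfData_le_one (c : ℕ → ℤ) (hc : InPolytope c) (hp5 : 5 ≤ p) (hwin : (c 0 + 2 : ℤ) < (p : ℤ) ^ 2) {s : ℕ}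
    (hs : s ≤ (c 0).toNat) (hcnt : classPoleCount c p s = 1) {o : ℕ} (ho : o < 6) : padicNorm p (pfData c o s) ≤ 1 := by
  have h := padicNorm_le_of_val (p := p) (m := 0) fun hne =>
    isolatedPoleIntegral_holds c p s o hc hp.out (by omega) hwin hs ho hne hcnt
  simpa using h

/-- The poles of `Q` are isolated, at level one, and `Q` is closed under `q ↦ b₀ − q` (unpacking of the test). -/
theorem qSet_spec (c : ℕ → ℤ)
    (hQ : ∀ x ∈ range p, defClass c p x = true → classPoleCount c p x = 1 ∧
      ∀ s ∈ classSet c p x, netExp c s < 0 → p ≤ s ∧ s < 2 * p ∧ inQ c p ((c 0).toNat - s) = true)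
    {s : ℕ} (hs : s ∈ qSet c p) :
    s ≤ (c 0).toNat ∧ classPoleCount c p s = 1 ∧ p ≤ s ∧ s < 2 * p ∧ (c 0).toNat - s ∈ qSet c p := by
  obtain ⟨hsR, hq⟩ := mem_filter.1 hs
  obtain ⟨hneg, hdef⟩ := (inQ_iff c p s).1 hq
  have hs' : s ≤ (c 0).toNat := by have := mem_range.1 hsR; omega
  obtain ⟨hcnt, hall⟩ := hQ (s % p) (mem_range.2 (Nat.mod_lt _ hp.out.pos)) hdef
  obtain ⟨hps, hs2, hmir⟩ := hall s (mem_classSet_mod c hs') hneg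
  refine ⟨hs', by rw [classPoleCount_mod]; exact hcnt, hps, hs2, mem_filter.2 ⟨mem_range.2 (by omega), hmir⟩⟩

/-- **Top layer:** `T_6 = Σ_Q c_{5,q} = 0` (reflection antisymmetry on the symmetric set `Q`). -/
theorem layerSum_five_eq_zero (c : ℕ → ℤ) (hc : InPolytope c)
    (hQ : ∀ x ∈ range p, defClass c p x = true → classPoleCount c p x = 1 ∧
      ∀ s ∈ classSet c p x, netExp c s < 0 → p ≤ s ∧ s < 2 * p ∧ inQ c p ((c 0).toNat - s) = true) :
    layerSum c p 5 = 0 := by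
  unfold layerSum
  refine Finset.sum_involution (fun s _ => (c 0).toNat - s) ?_ ?_ ?_ ?_
  · intro s hs
    obtain ⟨hs', -⟩ := qSet_spec c hQ hs
    rw [CellA.pfData_reflect c hc hs' (by norm_num)]; ring
  · intro s hs hne heq
    obtain ⟨hs', -⟩ := qSet_spec c hQ hs
    have h := CellA.pfData_reflect c hc hs' (show 5 < 6 by norm_num)
    rw [heq] at h
    exact hne (by linarith)
  · intro s hs
    exact (qSet_spec c hQ hs).2.2.2.2
  · intro s hs
    obtain ⟨hs', -⟩ := qSet_spec c hQ hs
    exact Nat.sub_sub_self hs'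

/-- **Layer five:** `‖T_5‖ ≤ p⁻¹` — `T_5 ≡ U(c) (mod p)` by Theorem A on the non-deficient poles, and `p ∣ U(c)` by THEOREM C. -/
theorem padicNorm_layerSum_four_le (c : ℕ → ℤ) (hc : InPolytope c) (hp5 : 5 ≤ p) (hwin : (c 0 + 2 : ℤ) < (p : ℤ) ^ 2)
    (hd : 4 * (p : ℤ) ≤ 2 * dOf c + 3) (hgood : GoodClasses c p 5)
    (hE : ∀ x ∈ range p, defClass c p x = false → ∀ s ∈ classSet c p x, netExp c s ≤ -5 → -4 ≤ classExp c p x) :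
    padicNorm p (layerSum c p 4) ≤ (p : ℚ) ^ (-1 : ℤ) := by
  have hU : padicNorm p (coeffU c) ≤ (p : ℚ) ^ (-1 : ℤ) := padicNorm_le_of_val fun hne => by
    have h := wrappedDivisibilityU_holds c p hc hp.out hp5 hwin hgood hne
    rwa [if_pos hd] at h
  have hsplit : layerSum c p 4 + ∑ s ∈ (range ((c 0).toNat + 1)).filter (fun s => ¬ inQ c p s = true), pfData c 4 s
      = coeffU c := by
    unfold layerSum qSet coeffU
    exact Finset.sum_filter_add_sum_filter_not _ _ _
  have hrest : padicNorm p (∑ s ∈ (range ((c 0).toNat + 1)).filter (fun s => ¬ inQ c p s = true), pfData c 4 s)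
      ≤ (p : ℚ) ^ (-1 : ℤ) := by
    refine padicNorm.sum_le' (fun s hs => ?_) (zpow_p_nonneg _)
    obtain ⟨hsR, hsQ⟩ := mem_filter.1 hs
    have hs' : s ≤ (c 0).toNat := by have := mem_range.1 hsR; omega
    by_cases hord : -netExp c s ≤ (4 : ℤ)
    · rw [CellA.pfData_eq_zero_of_order_le c hc hs' (by norm_num) (by exact_mod_cast hord), padicNorm.zero]
      exact zpow_p_nonneg _
    · have hneg : netExp c s < 0 := by omega
      have hndef : defClass c p (s % p) = false :=
        Bool.eq_false_iff.2 fun hdef => hsQ ((inQ_iff c p s).2 ⟨hneg, hdef⟩)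
      have hEx := hE (s % p) (mem_range.2 (Nat.mod_lt _ hp.out.pos)) hndef s (mem_classSet_mod c hs') (by omega)
      rw [← classExp_eq_of_mem (mem_classSet_mod c hs')] at hEx
      exact padicNorm_le_of_val fun hne => by
        have h := clusterBound_holds c p s 4 hc hp.out (by omega) hwin hs' (by norm_num) hne
        push_cast at h
        omega
  have heq : layerSum c p 4 = coeffU c - ∑ s ∈ (range ((c 0).toNat + 1)).filter (fun s => ¬ inQ c p s = true),
      pfData c 4 s := by
    rw [← hsplit]; ring
  rw [heq]
  exact (padicNorm.sub (p := p)).trans (max_le hU hrest)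

/-- **U-LAYER CASE (PROVED):** `v_p V(c) ≥ −4 ≥ t` under `uLayerCase c p t`. -/
theorem val_ge_of_uLayer (c : ℕ → ℤ) (hc : InPolytope c) (hp5 : 5 ≤ p) (hwin : (c 0 + 2 : ℤ) < (p : ℤ) ^ 2) {t : ℤ}
    (h : uLayerCase c p t = true) (hV : coeffV c ≠ 0) : t ≤ padicValRat p (coeffV c) := by
  simp only [uLayerCase, Bool.and_eq_true, decide_eq_true_eq] at h
  obtain ⟨⟨⟨⟨ht, hd⟩, hgood⟩, hQ⟩, hE⟩ := h
  have hp0 : (p : ℚ) ≠ 0 := Nat.cast_ne_zero.2 hp.out.ne_zero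
  have hp1 : (1 : ℚ) ≤ p := one_le_p
  have hp4 : (1 : ℚ) ≤ (p : ℚ) ^ 4 := one_le_pow₀ hp1
  -- (1) split `V` over the residue classes, deficient / non-deficient
  have hsplitV : coeffV c = ∑ x ∈ (range p).filter (fun x => defClass c p x = true), classV c p x
      + ∑ x ∈ (range p).filter (fun x => ¬ defClass c p x = true), classV c p x := by
    rw [coeffV_eq_sum_classV c hp.out.pos, Finset.sum_filter_add_sum_filter_not]
  -- (2) non-deficient classes: termwise (`classNuBound`)
  have hB : padicNorm p (∑ x ∈ (range p).filter (fun x => ¬ defClass c p x = true), classV c p x) ≤ (p : ℚ) ^ 4 := by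
    refine padicNorm.sum_le' (fun x hx => ?_) (by positivity)
    obtain ⟨hxr, hxP⟩ := mem_filter.1 hx
    have hx' := mem_range.1 hxr
    by_cases h0 : classPoleCount c p x = 0
    · rw [classV_eq_zero_of_noPole c hc h0, padicNorm.zero]; positivity
    · have h1 : 1 ≤ classPoleCount c p x := by omega
      have hnu : -4 ≤ classNu c p x := by
        by_contra hlt
        exact hxP ((defClass_iff c p x).2 ⟨h1, by omega⟩)
      calc padicNorm p (classV c p x) ≤ (p : ℚ) ^ (-classNu c p x) := padicNorm_classV_le c hc hp5 hwin hx' h1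
        _ ≤ (p : ℚ) ^ (4 : ℤ) := zpow_le_zpow_right₀ hp1 (by omega)
        _ = (p : ℚ) ^ 4 := zpow_ofNat (p : ℚ) 4
  -- (3) deficient classes, position-wise: only the poles of `Q` contribute
  have hfib : ∀ x ∈ (range p).filter (fun x => defClass c p x = true),
      classV c p x = ∑ s ∈ (qSet c p).filter (fun s => s % p = x), posV c s := by
    intro x hx
    obtain ⟨hxr, hPx⟩ := mem_filter.1 hx
    have hx' := mem_range.1 hxr
    have hxm : x % p = x := Nat.mod_eq_of_lt hx'
    have hcl : classV c p x = ∑ s ∈ classSet c p x, posV c s := rfl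
    rw [hcl]
    symm
    apply Finset.sum_subset
    · intro s hs
      obtain ⟨hsQ, hsx⟩ := mem_filter.1 hs
      obtain ⟨hsR, -⟩ := mem_filter.1 hsQ
      exact mem_filter.2 ⟨hsR, by rw [hsx, hxm]⟩
    · intro s hs hns
      obtain ⟨hsR, hsx⟩ := mem_filter.1 hs
      have hs' : s ≤ (c 0).toNat := by have := mem_range.1 hsR; omega
      have hsx' : s % p = x := by rw [hsx, hxm]
      have hnpole : ¬ netExp c s < 0 := by
        intro hneg
        apply hns
        refine mem_filter.2 ⟨mem_filter.2 ⟨hsR, (inQ_iff c p s).2 ⟨hneg, ?_⟩⟩, hsx'⟩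
        rw [hsx']; exact hPx
      refine Finset.sum_eq_zero fun o ho => ?_
      rw [CellA.pfData_eq_zero_of_order_le c hc hs' (mem_range.1 ho) (by omega), zero_mul]
  have hfw : ∑ x ∈ range p, ∑ s ∈ (qSet c p).filter (fun s => s % p = x), posV c s = ∑ s ∈ qSet c p, posV c s :=
    Finset.sum_fiberwise_of_maps_to (fun s _ => mem_range.2 (Nat.mod_lt s hp.out.pos)) _
  have hz : ∑ x ∈ (range p).filter (fun x => ¬ defClass c p x = true),
      ∑ s ∈ (qSet c p).filter (fun s => s % p = x), posV c s = 0 := by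
    refine Finset.sum_eq_zero fun x hx => Finset.sum_eq_zero fun s hs => ?_
    exfalso
    obtain ⟨-, hxP⟩ := mem_filter.1 hx
    obtain ⟨hsQ, hsx⟩ := mem_filter.1 hs
    obtain ⟨-, hq⟩ := mem_filter.1 hsQ
    have hdef := ((inQ_iff c p s).1 hq).2
    rw [hsx] at hdef
    exact hxP hdef
  have hA : ∑ x ∈ (range p).filter (fun x => defClass c p x = true), classV c p x = ∑ s ∈ qSet c p, posV c s := by
    rw [Finset.sum_congr rfl hfib, ← hfw, ← Finset.sum_filter_add_sum_filter_not (range p) (fun x => defClass c p x = true),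
      hz, add_zero]
  -- (4) level-one expansion on `Q`: `posV s − posVsing s` is `p`-integral
  have hFG : ∀ s ∈ qSet c p, padicNorm p (posV c s - posVsing c p s) ≤ 1 := by
    intro s hs
    obtain ⟨hs', hcnt, hps, hs2, -⟩ := qSet_spec c hQ hs
    have hsub : posV c s - posVsing c p s = ∑ o ∈ range 6, pfData c o s * (harm (o + 1) s - 1 / (p : ℚ) ^ (o + 1)) := by
      unfold posV posVsing
      rw [← Finset.sum_sub_distrib]
      exact Finset.sum_congr rfl fun o _ => by ring
    rw [hsub]
    refine padicNorm.sum_le' (fun o ho => ?_) zero_le_one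
    rw [padicNorm.mul]
    calc padicNorm p (pfData c o s) * padicNorm p (harm (o + 1) s - 1 / (p : ℚ) ^ (o + 1)) ≤ 1 * 1 :=
          mul_le_mul (padicNorm_pfData_le_one c hc hp5 hwin hs' hcnt (mem_range.1 ho))
            (padicNorm_harm_sub_inv_pow_le_one hps hs2 (o + 1)) (padicNorm.nonneg _) zero_le_one
      _ = 1 := one_mul 1
  -- (5) the singular parts, summed over `Q`, are the layers
  have hGsum : ∑ s ∈ qSet c p, posVsing c p s = ∑ o ∈ range 6, layerSum c p o / (p : ℚ) ^ (o + 1) := by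
    unfold posVsing layerSum
    rw [Finset.sum_comm]
    exact Finset.sum_congr rfl fun o _ => by rw [Finset.sum_div]
  -- (6) layer by layer
  have hint : ∀ o ∈ range 6, padicNorm p (layerSum c p o) ≤ 1 := fun o ho =>
    padicNorm.sum_le' (fun s hs => by
      obtain ⟨hs', hcnt, -⟩ := qSet_spec c hQ hs
      exact padicNorm_pfData_le_one c hc hp5 hwin hs' hcnt (mem_range.1 ho)) zero_le_one
  have hlay : ∀ o ∈ range 6, padicNorm p (layerSum c p o / (p : ℚ) ^ (o + 1)) ≤ (p : ℚ) ^ 4 := by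
    intro o ho
    have ho6 := mem_range.1 ho
    have hio := hint o ho
    rw [padicNorm.div, CellA.padicNorm_p_pow, div_inv_eq_mul]
    by_cases h5 : o = 5
    · subst h5
      rw [layerSum_five_eq_zero c hc hQ, padicNorm.zero, zero_mul]; positivity
    by_cases h4 : o = 4
    · subst h4
      have h := padicNorm_layerSum_four_le c hc hp5 hwin hd hgood hE
      calc padicNorm p (layerSum c p 4) * (p : ℚ) ^ (4 + 1) ≤ (p : ℚ) ^ (-1 : ℤ) * (p : ℚ) ^ (4 + 1) :=
            mul_le_mul_of_nonneg_right h (by positivity)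
        _ = (p : ℚ) ^ 4 := by
            rw [zpow_neg_one, pow_succ, mul_comm ((p : ℚ) ^ 4) (p : ℚ), ← mul_assoc, inv_mul_cancel₀ hp0, one_mul]
    · have ho3 : o + 1 ≤ 4 := by omega
      calc padicNorm p (layerSum c p o) * (p : ℚ) ^ (o + 1) ≤ 1 * (p : ℚ) ^ 4 :=
            mul_le_mul hio (pow_le_pow_right₀ hp1 ho3) (by positivity) zero_le_one
        _ = (p : ℚ) ^ 4 := one_mul _
  -- (7) assemble
  have hQsum : padicNorm p (∑ s ∈ qSet c p, posV c s) ≤ (p : ℚ) ^ 4 := by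
    have hdecomp : ∑ s ∈ qSet c p, posV c s
        = ∑ s ∈ qSet c p, (posV c s - posVsing c p s) + ∑ o ∈ range 6, layerSum c p o / (p : ℚ) ^ (o + 1) := by
      rw [← hGsum, ← Finset.sum_add_distrib]
      exact Finset.sum_congr rfl fun s _ => by ring
    rw [hdecomp]
    refine (padicNorm.nonarchimedean (p := p)).trans (max_le ?_ ?_)
    · exact (padicNorm.sum_le' hFG zero_le_one).trans hp4
    · exact padicNorm.sum_le' hlay (by positivity)
  have hmain : padicNorm p (coeffV c) ≤ (p : ℚ) ^ 4 := by
    rw [hsplitV, hA]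
    exact (padicNorm.nonarchimedean (p := p)).trans (max_le hQsum hB)
  have hmain' : padicNorm p (coeffV c) ≤ (p : ℚ) ^ (-(-4 : ℤ)) := by
    rw [neg_neg]; exact_mod_cast hmain
  exact ht.trans (val_ge_of_padicNorm_le hV hmain')

end ULayer

end Summit.KontsevichZagierPeriods.Zeta5Search.ClusterValuation
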